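import Literature.NumberTheory.DiophantineGeometry.GenEllDePersistentFamily
import Literature.NumberTheory.DiophantineGeometry.GenEllDeRamificationArchFamily
import Mathlib.FieldTheory.IsAlgClosed.AlgebraicClosure
import Mathlib.FieldTheory.AlgebraicClosure
import HarnessLib

/-!
# [GenEll] Thm. 2.1 for `ℙ¹`, the `D_e` route: the persistent family as pairwise coprime
# `ℚ`-polynomials

S. Mochizuki, *Arithmetic elliptic curves in general position*, Math. J. Okayama Univ. 52 (2010)
[cite: MochizukiGenEll2010, Thm 2.1 p.12].  Third part of the «bad-`c` lemma» of the abc-iut cell's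
`D_e` route to the route item GenEllTwo (`Summit.ABC.ABC.Theses.IUTThetaPilot`): after
`GenEllDeCriticalCollisions` (the persistent set of a member `t_c` of the family
`t_c = 1/r + c·r^{k+1}/(1−2x)` on `D_e : r^{2k+1} = x(1−x)` is finite; a fixed point collides with
critical points for finitely many `c`) and `GenEllDePersistentFamily` (finitely many nonzero rationals
with pairwise disjoint persistent sets in two given fields), this file packages the persistent sets as
`ℚ`-POLYNOMIALS, the currency of the cell's persistent-family spine
(`vojtaIneq_univ_of_persistent`: `Pers : ι → ℚ[X]`, nonzero, pairwise coprime, with roots at `∞`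
(in `ℂ`) and at `2` (in `Q̄₂`) covering the persistent sets):

* transport of the point predicates along ring homomorphisms (`map_onCurve_iff`,
  `map_nonSpecial_iff`, `map_collide_iff`, `mem_persistentSet_map`; `map_N'` is
  `GenEllDeRamificationArchFamily`'s);
* `DeFamily.mem_algebraicClosure_of_mem_persistentSet` — every coordinate of a persistent
  configuration (the point `P`, the critical point `Q`) is ALGEBRAIC over `ℚ` (resultants with the
  irreducible curve polynomial, twice, plus integrality of `r` over `ℚ(x)`);
* `DeFamily.persPoly` — the product of the minimal polynomials of the persistent set computed in
  `Q̄ = AlgebraicClosure ℚ`; `persPoly_ne_zero`; `aeval_persPoly_eq_zero` — in ANY algebraically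
  closed field of characteristic `0` every persistent point is a root (embed the algebraic
  configuration into `Q̄`); `isCoprime_persPoly` — disjoint persistent sets in `Q̄` give coprime
  polynomials (a common root is a conjugate `ψ a`, and conjugation preserves persistence);
* `DeFamily.exists_persistent_polys` — **for `k ≥ 3` and every `n`: nonzero rationals
  `c₁, …, c_n` and nonzero pairwise coprime `Pers₁, …, Pers_n ∈ ℚ[X]` such that in any two
  algebraically closed fields `Ω₁, Ω₂` of characteristic `0` every point of the persistent set of
  `t_{c_i}` is a root of `Pers_i`** — the `(Pers, hPers0, hPcop)` input of the spine with
  `n = 2d+1`, `Ω₁ = ℂ`, `Ω₂ = Q̄₂`.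

Classical algebra; nothing here bears on the disputed parts of the abc-iut corpus.
-/

noncomputable section

open Polynomial

namespace Literature.NumberTheory.DiophantineGeometry.GenEll

namespace DeFamily

/-! ### Transport of the point predicates along ring homomorphisms -/

section Transport

variable {Ω Ω' : Type*} [Field Ω] [Field Ω'] (φ : Ω →+* Ω')

/-- [cite: MochizukiGenEll2010, Thm 2.1 p.12] -/
theorem map_onCurve_iff (k : ℕ) (P : Ω × Ω) : OnCurve k (φ P.1, φ P.2) ↔ OnCurve k P := by
  unfold OnCurve
  rw [← map_one φ, ← map_sub, ← map_mul, ← map_pow]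
  exact φ.injective.eq_iff

/-- [cite: MochizukiGenEll2010, Thm 2.1 p.12] -/
theorem map_nonSpecial_iff (P : Ω × Ω) : NonSpecial (φ P.1, φ P.2) ↔ NonSpecial P := by
  unfold NonSpecial
  have h2 : (1 : Ω') - 2 * φ P.1 = φ (1 - 2 * P.1) := by
    rw [map_sub, map_one, map_mul, map_ofNat]
  rw [h2, map_ne_zero_iff φ φ.injective]
  exact Iff.rfl.and (map_ne_zero_iff φ φ.injective)

/-- [cite: MochizukiGenEll2010, Thm 2.1 p.12] -/
theorem map_collide_iff (k : ℕ) (c : Ω) (P Q : Ω × Ω) :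
    Collide k (φ c) (φ P.1, φ P.2) (φ Q.1, φ Q.2) ↔ Collide k c P Q := by
  unfold Collide
  rw [← φ.injective.eq_iff]
  simp only [map_sub, map_mul, map_pow, map_one, map_ofNat]

/-- Persistence is transported along ring homomorphisms (for a RATIONAL parameter `c`, which every
ring homomorphism of characteristic-`0` fields fixes). [cite: MochizukiGenEll2010, Thm 2.1 p.12] -/
theorem mem_persistentSet_map {k : ℕ} {c : ℚ} {a : Ω}
    (ha : a ∈ persistentSet k (c : Ω)) : φ a ∈ persistentSet k (c : Ω') := by
  obtain ⟨P, rfl, hP, hns, Q, hQ, hN, hcol⟩ := ha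
  refine ⟨(φ P.1, φ P.2), rfl, (map_onCurve_iff φ k P).mpr hP, (map_nonSpecial_iff φ P).mpr hns,
    (φ Q.1, φ Q.2), (map_onCurve_iff φ k Q).mpr hQ, ?_, ?_⟩
  · rw [← map_N_ratCast φ k c Q.1 Q.2]
    show φ (N k (c : Ω) Q) = 0
    rw [hN, map_zero]
  · rw [← map_ratCast φ c, map_collide_iff]; exact hcol

end Transport

/-! ### Algebraicity of persistent configurations -/

section Algebraic

variable {K Ω : Type*} [Field K] [Field Ω] [Algebra K Ω]

/-- Evaluation of the curve polynomial over `K` at a point of `Ω`. [cite: MochizukiGenEll2010, Thm 2.1 p.12] -/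
theorem eval_map_curvePoly (k : ℕ) (x r : Ω) :
    (((curvePoly k : K[X][X]).map (aeval x).toRingHom).eval r) = r ^ (2 * k + 1) - x * (1 - x) := by
  simp [curvePoly, Polynomial.map_sub, Polynomial.map_pow, Polynomial.map_mul]

/-- Evaluation of `N_c` over `K` at a point of `Ω`. [cite: MochizukiGenEll2010, Thm 2.1 p.12] -/
theorem eval_map_NPoly (k : ℕ) (c : K) (x r : Ω) :
    (((NPoly k c).map (aeval x).toRingHom).eval r) = N k (algebraMap K Ω c) (x, r) := by
  rw [eval_map]
  simp only [NPoly, N, eval₂_add, eval₂_neg, eval₂_sub, eval₂_mul, eval₂_pow, eval₂_C, eval₂_X,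
    eval₂_one, eval₂_ofNat, eval₂_natCast, AlgHom.toRingHom_eq_coe, RingHom.coe_coe, aeval_X, aeval_C]

/-- Evaluation of the fibre-collision polynomial over `K` at a point of `Ω`.
[cite: MochizukiGenEll2010, Thm 2.1 p.12] -/
theorem eval_map_fibrePoly (k : ℕ) (c rQ sQ : K) (x r : Ω) :
    (((fibrePoly k c rQ sQ).map (aeval x).toRingHom).eval r) =
      (r - algebraMap K Ω rQ) * (1 - 2 * x) * algebraMap K Ω sQ -
        algebraMap K Ω c * r * algebraMap K Ω rQ *
          (r ^ (k + 1) * algebraMap K Ω sQ - algebraMap K Ω rQ ^ (k + 1) * (1 - 2 * x)) := by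
  rw [eval_map]
  simp only [fibrePoly, eval₂_add, eval₂_sub, eval₂_neg, eval₂_mul, eval₂_C, eval₂_X, eval₂_pow,
    eval₂_one, eval₂_ofNat, AlgHom.toRingHom_eq_coe, RingHom.coe_coe, aeval_C, aeval_X,
    map_neg, map_mul, map_pow, map_sub, map_add, map_one, map_ofNat]
  ring

/-- Over any field, the curve polynomial and `N_c` are coprime in `K(x)[Y]`
(`k ≥ 2`). [cite: MochizukiGenEll2010, Thm 2.1 p.12] -/
theorem isCoprime_curvePoly_NPoly {k : ℕ} (hk : 2 ≤ k) (c : K) :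
    IsCoprime ((curvePoly k : K[X][X]).map (algebraMap K[X] (RatFunc K)))
      ((NPoly k c).map (algebraMap K[X] (RatFunc K))) := by
  have hmonic : (curvePoly k : K[X][X]).Monic := monic_X_pow_sub_C _ (by omega)
  refine PlaneCurve.isCoprime_map_of_irreducible _ _ hmonic
    (PlaneCurve.irreducible_X_pow_sub_C_X_mul_one_sub_X (2 * k + 1) (by omega)) fun h => ?_
  have hR : curvePoly k ∣ NRem k c := by
    have : NRem k c = NPoly k c - curvePoly k * (-2 * C (C c) * X ^ (k + 2)) := by
      rw [NPoly_eq]; ring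
    rw [this]; exact dvd_sub h (dvd_mul_right _ _)
  exact not_dvd_of_natDegree_lt k (NRem_ne_zero k c) ((natDegree_NRem_le k c).trans_lt (by omega)) hR

/-- Over any field, the curve polynomial and the fibre-collision polynomial of
a non-special point (`c ≠ 0`) are coprime in `K(x)[Y]` (`k ≥ 2`). [cite: MochizukiGenEll2010, Thm 2.1 p.12] -/
theorem isCoprime_curvePoly_fibrePoly {k : ℕ} (hk : 2 ≤ k) {c rQ sQ : K} (hc : c ≠ 0) (hr : rQ ≠ 0)
    (hs : sQ ≠ 0) :
    IsCoprime ((curvePoly k : K[X][X]).map (algebraMap K[X] (RatFunc K)))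
      ((fibrePoly k c rQ sQ).map (algebraMap K[X] (RatFunc K))) := by
  have hmonic : (curvePoly k : K[X][X]).Monic := monic_X_pow_sub_C _ (by omega)
  exact PlaneCurve.isCoprime_map_of_irreducible _ _ hmonic
    (PlaneCurve.irreducible_X_pow_sub_C_X_mul_one_sub_X (2 * k + 1) (by omega))
    (not_dvd_of_natDegree_lt k (fibrePoly_ne_zero k hc hr hs)
      ((natDegree_fibrePoly_le k c rQ sQ).trans_lt (by omega)))

variable [Algebra ℚ K] [Algebra ℚ Ω] [IsScalarTower ℚ K Ω] [Algebra.IsAlgebraic ℚ K]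

/-- `r` is integral over `ℚ` as soon as `(x, r) ∈ D_e(Ω)` with `x` in the algebraic subfield `K`.
[cite: MochizukiGenEll2010, Thm 2.1 p.12] -/
theorem isIntegral_snd_of_onCurve {k : ℕ} {P : Ω × Ω} (hP : OnCurve k P) {x : K}
    (hx : algebraMap K Ω x = P.1) : IsIntegral ℚ P.2 := by
  refine isIntegral_trans (A := K) P.2
    ⟨X ^ (2 * k + 1) - C (x * (1 - x)), monic_X_pow_sub_C _ (by omega), ?_⟩
  rw [eval₂_sub, eval₂_X_pow, eval₂_C, map_mul, map_sub, map_one, hx, hP, sub_self]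

/-- The `x`-coordinate of a `t_c`-critical point (`c ∈ K`) is integral over `ℚ`: it is a root of the
nonzero resultant `Res_Y(f, N_c) ∈ K[x]`. [cite: MochizukiGenEll2010, Thm 2.1 p.12] -/
theorem isIntegral_fst_of_critical {k : ℕ} (hk : 2 ≤ k) (c : K) {Q : Ω × Ω} (hQ : OnCurve k Q)
    (hN : N k (algebraMap K Ω c) Q = 0) : IsIntegral ℚ Q.1 := by
  refine isIntegral_trans (A := K) Q.1 (IsAlgebraic.isIntegral ⟨resultant (curvePoly k) (NPoly k c),
    PlaneCurve.resultant_ne_zero_of_isCoprime_map _ _ (monic_X_pow_sub_C _ (by omega))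
      (isCoprime_curvePoly_NPoly hk c), ?_⟩)
  refine PlaneCurve.aeval_resultant_eq_zero_of_common_zero _ _ ?_ Q.1 Q.2 ?_ ?_
  · rw [curvePoly, natDegree_X_pow_sub_C]; omega
  · rw [eval_map_curvePoly, hQ, sub_self]
  · rw [eval_map_NPoly, hN]

/-- The `x`-coordinate of a point colliding under `t_c` (`c ∈ K`, `c ≠ 0`) with a fixed non-special
point `Q` with coordinates in `K` is integral over `ℚ`: it is a root of the nonzero resultant
`Res_Y(f, Ψ_Q) ∈ K[x]`. [cite: MochizukiGenEll2010, Thm 2.1 p.12] -/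
theorem isIntegral_fst_of_collide {k : ℕ} (hk : 2 ≤ k) {c xQ rQ : K} (hc : c ≠ 0) (hr : rQ ≠ 0)
    (hs : 1 - 2 * xQ ≠ 0) {P : Ω × Ω} (hP : OnCurve k P)
    (hcol : Collide k (algebraMap K Ω c) P (algebraMap K Ω xQ, algebraMap K Ω rQ)) :
    IsIntegral ℚ P.1 := by
  refine isIntegral_trans (A := K) P.1 (IsAlgebraic.isIntegral
    ⟨resultant (curvePoly k) (fibrePoly k c rQ (1 - 2 * xQ)),
    PlaneCurve.resultant_ne_zero_of_isCoprime_map _ _ (monic_X_pow_sub_C _ (by omega))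
      (isCoprime_curvePoly_fibrePoly hk hc hr hs), ?_⟩)
  refine PlaneCurve.aeval_resultant_eq_zero_of_common_zero _ _ ?_ P.1 P.2 ?_ ?_
  · rw [curvePoly, natDegree_X_pow_sub_C]; omega
  · rw [eval_map_curvePoly, hP, sub_self]
  · rw [eval_map_fibrePoly]
    unfold Collide at hcol
    simp only [map_sub, map_one, map_mul, map_ofNat] at hcol ⊢
    linear_combination hcol

end Algebraic

/-! ### Every persistent configuration lies in the algebraic closure of `ℚ` -/

section Closure

variable {Ω : Type*} [Field Ω] [CharZero Ω]

/-- In a field `Ω` of characteristic `0`, all four coordinates of a persistent configuration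
(`P` non-special on the curve colliding under `t_c`, `c ∈ ℚ^×`, with a critical point `Q`) lie in
the relative algebraic closure `algebraicClosure ℚ Ω`. [cite: MochizukiGenEll2010, Thm 2.1 p.12] -/
theorem mem_algebraicClosure_of_persistent {k : ℕ} (hk : 2 ≤ k) {c : ℚ} (hc : c ≠ 0) {P Q : Ω × Ω}
    (hP : OnCurve k P) (hQ : OnCurve k Q) (hN : N k (c : Ω) Q = 0) (hcol : Collide k (c : Ω) P Q) :
    P.1 ∈ algebraicClosure ℚ Ω ∧ P.2 ∈ algebraicClosure ℚ Ω ∧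
      Q.1 ∈ algebraicClosure ℚ Ω ∧ Q.2 ∈ algebraicClosure ℚ Ω := by
  haveI hLalg : Algebra.IsAlgebraic ℚ (algebraicClosure ℚ Ω) := algebraicClosure.isAlgebraic ℚ Ω
  let L : IntermediateField ℚ Ω := algebraicClosure ℚ Ω
  have hcL : algebraMap L Ω (c : L) = (c : Ω) := map_ratCast _ c
  have hcL0 : (c : L) ≠ 0 := fun h =>
    (Rat.cast_ne_zero.mpr hc : (c : Ω) ≠ 0) (by rw [← hcL, h, map_zero])
  -- `Q`
  have hQ1 : Q.1 ∈ L := by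
    rw [mem_algebraicClosure_iff']
    exact isIntegral_fst_of_critical (K := L) hk (c : L) hQ (by rw [hcL]; exact hN)
  have hQ2 : Q.2 ∈ L := by
    rw [mem_algebraicClosure_iff']
    exact isIntegral_snd_of_onCurve (K := L) hQ (x := ⟨Q.1, hQ1⟩) rfl
  -- `P`
  obtain ⟨hrQ, hsQ⟩ := nonSpecial_of_N_eq_zero (Rat.cast_ne_zero.mpr hc) hQ hN
  have hP1 : P.1 ∈ L := by
    rw [mem_algebraicClosure_iff']
    refine isIntegral_fst_of_collide (K := L) hk (c := (c : L)) (xQ := ⟨Q.1, hQ1⟩) (rQ := ⟨Q.2, hQ2⟩)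
      hcL0 ?_ ?_ hP ?_
    · intro h
      exact hrQ (by rw [show Q.2 = algebraMap L Ω ⟨Q.2, hQ2⟩ from rfl, h, map_zero])
    · intro h
      have e : algebraMap L Ω (1 - 2 * ⟨Q.1, hQ1⟩) = 1 - 2 * Q.1 := by
        rw [map_sub, map_one, map_mul, map_ofNat]; rfl
      exact hsQ (by rw [← e, h, map_zero])
    · rw [hcL]; exact hcol
  have hP2 : P.2 ∈ L := by
    rw [mem_algebraicClosure_iff']
    exact isIntegral_snd_of_onCurve (K := L) hP (x := ⟨P.1, hP1⟩) rfl
  exact ⟨hP1, hP2, hQ1, hQ2⟩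

end Closure

/-! ### The persistent polynomials over `Q̄` -/

section Polys

/-- The PERSISTENT POLYNOMIAL of the family member `c ∈ ℚ^×`: the product of the minimal
polynomials over `ℚ` of the (finitely many) points of the persistent set of `t_c` in `Q̄`.
[cite: MochizukiGenEll2010, Thm 2.1 p.12] -/
def persPoly {k : ℕ} (hk : 2 ≤ k) {c : ℚ} (hc : c ≠ 0) : ℚ[X] :=
  ∏ a ∈ (finite_persistentSet (Ω := AlgebraicClosure ℚ) hk (Rat.cast_ne_zero.mpr hc)).toFinset,
    minpoly ℚ a

/-- The persistent polynomial is nonzero. [cite: MochizukiGenEll2010, Thm 2.1 p.12] -/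
theorem persPoly_ne_zero {k : ℕ} (hk : 2 ≤ k) {c : ℚ} (hc : c ≠ 0) : persPoly hk hc ≠ 0 := by
  haveI hK : Algebra.IsAlgebraic ℚ (AlgebraicClosure ℚ) := AlgebraicClosure.isAlgebraic ℚ
  exact Finset.prod_ne_zero_iff.mpr fun a _ => minpoly.ne_zero (Algebra.IsIntegral.isIntegral a)

/-- Every persistent point of `t_c` in `Q̄` is a root of the persistent polynomial.
[cite: MochizukiGenEll2010, Thm 2.1 p.12] -/
theorem aeval_persPoly_of_mem {k : ℕ} (hk : 2 ≤ k) {c : ℚ} (hc : c ≠ 0)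
    {a : AlgebraicClosure ℚ} (ha : a ∈ persistentSet k (c : AlgebraicClosure ℚ)) :
    aeval a (persPoly hk hc) = 0 := by
  unfold persPoly
  rw [map_prod]
  exact Finset.prod_eq_zero ((Set.Finite.mem_toFinset _).mpr ha) (minpoly.aeval ℚ a)

/-- **Roots at every place.** In any algebraically closed field `Ω` of characteristic `0` (e.g. `ℂ`,
`Q̄₂`), every point of the persistent set of `t_c` is a root of the persistent polynomial: the
persistent configuration is algebraic, so it embeds into `Q̄`, where persistence is preserved.
[cite: MochizukiGenEll2010, Thm 2.1 p.12] -/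
theorem aeval_persPoly_eq_zero {Ω : Type*} [Field Ω] [CharZero Ω] [IsAlgClosed Ω] {k : ℕ}
    (hk : 2 ≤ k) {c : ℚ} (hc : c ≠ 0) {a : Ω} (ha : a ∈ persistentSet k (c : Ω)) :
    aeval a (persPoly hk hc) = 0 := by
  haveI hK : Algebra.IsAlgebraic ℚ (AlgebraicClosure ℚ) := AlgebraicClosure.isAlgebraic ℚ
  haveI hLalg : Algebra.IsAlgebraic ℚ (algebraicClosure ℚ Ω) := algebraicClosure.isAlgebraic ℚ Ω
  obtain ⟨P, rfl, hP, hns, Q, hQ, hN, hcol⟩ := ha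
  obtain ⟨hP1, hP2, hQ1, hQ2⟩ := mem_algebraicClosure_of_persistent hk hc hP hQ hN hcol
  let L : IntermediateField ℚ Ω := algebraicClosure ℚ Ω
  -- the configuration as `L`-points
  let P' : L × L := (⟨P.1, hP1⟩, ⟨P.2, hP2⟩)
  let Q' : L × L := (⟨Q.1, hQ1⟩, ⟨Q.2, hQ2⟩)
  have hι : ∀ z : L, algebraMap L Ω z = (z : Ω) := fun z => rfl
  have hP'1 : (algebraMap L Ω P'.1, algebraMap L Ω P'.2) = P := rfl
  have hQ'1 : (algebraMap L Ω Q'.1, algebraMap L Ω Q'.2) = Q := rfl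
  have hmem : (P'.1 : L) ∈ persistentSet k (c : L) := by
    refine ⟨P', rfl, ?_, ?_, Q', ?_, ?_, ?_⟩
    · exact (map_onCurve_iff (algebraMap L Ω) k P').mp (hP'1 ▸ hP)
    · exact (map_nonSpecial_iff (algebraMap L Ω) P').mp (hP'1 ▸ hns)
    · exact (map_onCurve_iff (algebraMap L Ω) k Q').mp (hQ'1 ▸ hQ)
    · apply (algebraMap L Ω).injective
      rw [map_N', map_ratCast, map_zero]
      exact hN
    · refine (map_collide_iff (algebraMap L Ω) k (c : L) P' Q').mp ?_
      rw [map_ratCast]; exact hcol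
  -- embed `L` into `Q̄`
  let ψ : L →ₐ[ℚ] AlgebraicClosure ℚ := IsAlgClosed.lift
  have hψ : ψ P'.1 ∈ persistentSet k (c : AlgebraicClosure ℚ) :=
    mem_persistentSet_map ψ.toRingHom hmem
  have h1 := aeval_persPoly_of_mem hk hc hψ
  have hdvd : minpoly ℚ P.1 ∣ persPoly hk hc := by
    have e1 : minpoly ℚ (ψ P'.1) = minpoly ℚ P'.1 := minpoly.algHom_eq ψ ψ.injective _
    have e2 : minpoly ℚ ((IntermediateField.val L) P'.1) = minpoly ℚ P'.1 :=
      minpoly.algHom_eq (IntermediateField.val L) (IntermediateField.val L).injective _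
    rw [← minpoly.dvd_iff] at h1
    rw [e1, ← e2] at h1
    exact h1
  exact aeval_eq_zero_of_dvd_aeval_eq_zero hdvd (minpoly.aeval ℚ _)

/-- **Coprimality from disjointness in `Q̄`.** If the persistent sets of `t_c` and `t_{c'}` in `Q̄`
are disjoint, the persistent polynomials are coprime: a common root in `Q̄` would be a conjugate
`ψ a` of a persistent point `a` of `t_c`, itself persistent (conjugation preserves persistence), and
likewise for `c'`. [cite: MochizukiGenEll2010, Thm 2.1 p.12] -/
theorem isCoprime_persPoly {k : ℕ} (hk : 2 ≤ k) {c c' : ℚ} (hc : c ≠ 0) (hc' : c' ≠ 0)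
    (hdisj : Disjoint (persistentSet k (c : AlgebraicClosure ℚ))
      (persistentSet k (c' : AlgebraicClosure ℚ))) :
    IsCoprime (persPoly hk hc) (persPoly hk hc') := by
  haveI hK : Algebra.IsAlgebraic ℚ (AlgebraicClosure ℚ) := AlgebraicClosure.isAlgebraic ℚ
  rw [Polynomial.isCoprime_iff_aeval_ne_zero_of_isAlgClosed ℚ (AlgebraicClosure ℚ)]
  intro b
  by_contra h
  rw [not_or, not_ne_iff, not_ne_iff] at h
  -- a root of `persPoly c` in `Q̄` is persistent for `c`
  have key : ∀ {c₀ : ℚ} (hc₀ : c₀ ≠ 0), aeval b (persPoly hk hc₀) = 0 →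
      b ∈ persistentSet k (c₀ : AlgebraicClosure ℚ) := by
    intro c₀ hc₀ hb
    unfold persPoly at hb
    rw [map_prod, Finset.prod_eq_zero_iff] at hb
    obtain ⟨a, ha, hab⟩ := hb
    have ha' := (Set.Finite.mem_toFinset _).mp ha
    have hroot : b ∈ (minpoly ℚ a).rootSet (AlgebraicClosure ℚ) :=
      (mem_rootSet_of_ne (minpoly.ne_zero (Algebra.IsIntegral.isIntegral a))).mpr hab
    rw [← Algebra.IsAlgebraic.range_eval_eq_rootSet_minpoly] at hroot
    obtain ⟨ψ, rfl⟩ := hroot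
    exact mem_persistentSet_map ψ.toRingHom ha'
  exact Set.disjoint_left.mp hdisj (key hc h.1) (key hc' h.2)

/-- **The persistent family as pairwise coprime `ℚ`-polynomials** (the `(c, Pers, hPers0, hPcop)`
input of the cell's persistent-family spine). For `k ≥ 3` and every `n` there are nonzero, pairwise
distinct rationals `c₁, …, c_n` and nonzero, pairwise coprime `Pers₁, …, Pers_n ∈ ℚ[X]` such that,
in any two algebraically closed fields `Ω₁, Ω₂` of characteristic `0`, every point of the persistent
set of `t_{c_i}` is a root of `Pers_i`. [cite: MochizukiGenEll2010, Thm 2.1 p.12] -/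
theorem exists_persistent_polys (Ω₁ Ω₂ : Type*) [Field Ω₁] [CharZero Ω₁] [IsAlgClosed Ω₁]
    [Field Ω₂] [CharZero Ω₂] [IsAlgClosed Ω₂] {k : ℕ} (hk : 3 ≤ k) (n : ℕ) :
    ∃ (c : Fin n → ℚ) (Pers : Fin n → ℚ[X]), (∀ i, c i ≠ 0) ∧ Function.Injective c ∧
      (∀ i, Pers i ≠ 0) ∧ Pairwise (fun i j => IsCoprime (Pers i) (Pers j)) ∧
      (∀ i, ∀ a ∈ persistentSet k (c i : Ω₁), aeval a (Pers i) = 0) ∧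
      (∀ i, ∀ a ∈ persistentSet k (c i : Ω₂), aeval a (Pers i) = 0) := by
  have hk2 : 2 ≤ k := by omega
  obtain ⟨c, hc0, hcinj, hdisj, -⟩ :=
    exists_params_pairwise_disjoint (Ω₁ := AlgebraicClosure ℚ) (Ω₂ := AlgebraicClosure ℚ) hk n
  refine ⟨c, fun i => persPoly hk2 (hc0 i), hc0, hcinj, fun i => persPoly_ne_zero hk2 (hc0 i),
    fun i j hij => isCoprime_persPoly hk2 (hc0 i) (hc0 j) (hdisj hij),
    fun i a ha => aeval_persPoly_eq_zero hk2 (hc0 i) ha,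
    fun i a ha => aeval_persPoly_eq_zero hk2 (hc0 i) ha⟩

end Polys

end DeFamily

end Literature.NumberTheory.DiophantineGeometry.GenEll
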